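import Summits.HodgeConjecture.HodgeConjecture.Theses.AmpleAdicLefschetz

/-!
# Route AmpleAdicLefschetz — `Assembly` (item stmt-HodgeConjecture-10727)

The assembly item of route `route-HodgeConjecture-AmpleAdicLefschetz` is the implication

`HodgeModelsExist → WeakLefschetzInjective → HardLefschetzReduction → MiddleStabilisation →
ThickDescent → SectionalSource → HodgeConjecture`,

i.e. the route's deciding theorem
`Summit.HodgeConjecture.HodgeConjecture.Theses.AmpleAdicLefschetz.closes` re-curried.  The proof
below is self-contained (pure logic + `Nat` arithmetic over the six items; it does not refer to
`closes`, so it does not depend on the regeneration of the route file):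

1. below the middle (`2p + 1 ≤ n`): `SectionalSource` gives a proper affine-complement section
   `f : Y ⟶ X` (with its finite affine cover `s` of `X ∖ f(Y)`, `2p + |s| ≤ n`) on which `f^* c`
   is algebraic, `ThickDescent` descends an algebraic class `a` of `X` with `f^* a = f^* c`, and
   `WeakLefschetzInjective` (degree `2p`, `2p + |s| ≤ n`) gives `a = c`;
2. in the middle (`2p = n`): `MiddleStabilisation` reduces to case 1 in dimension `2p + 1`;
3. above the middle (`n < 2p`): `HardLefschetzReduction` reduces to degree `2(n - p) ≤ n`,
   i.e. to case 1 or 2;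

and `HodgeModelsExist` supplies the Hodge-model conjunct of `HodgeConjectureFor n X`.
-/

-- `Summit.HodgeConjecture.HodgeConjecture.Theorems` is the mandated namespace (single-conjunct summit:
-- Sub = Summit), which `linter.dupNamespace` flags on every declaration; the lakefile turns the
-- linter off tree-wide (weak option), restated here so stand-alone elaboration is warning-free too.
set_option linter.dupNamespace false

namespace Summit.HodgeConjecture.HodgeConjecture.Theorems

open Summit.HodgeConjecture.HodgeConjecture.Theses.AmpleAdicLefschetz
open Literature.AlgebraicGeometry.HodgeTheory Literature.AlgebraicGeometry.Motives

/-- **Item stmt-HodgeConjecture-10727 (`Assembly`)** of route `AmpleAdicLefschetz`: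
`HodgeModelsExist → WeakLefschetzInjective → HardLefschetzReduction → MiddleStabilisation →
ThickDescent → SectionalSource → HodgeConjecture`.  Pure logic over the items: below the middle
(`2p + 1 ≤ n`) a rational `(p,p)` class `c` becomes algebraic on a proper affine-complement section
(`SectionalSource`), descends to an algebraic class `a` of `X` with the same restriction
(`ThickDescent`), and `a = c` by weak Lefschetz injectivity (`WeakLefschetzInjective`); the middle
degree `2p = n` is `MiddleStabilisation` fed with the previous case in dimension `2p + 1`; above the
middle `HardLefschetzReduction` moves to degree `2(n - p) ≤ n`; `HodgeModelsExist` gives the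
Hodge-model conjunct.  The type is literally the route decl
`Summit.HodgeConjecture.HodgeConjecture.Theses.AmpleAdicLefschetz.Assembly` (the deciding theorem
`closes` re-curried). -/
theorem ampleAdicLefschetz_assembly_proof :
    Summit.HodgeConjecture.HodgeConjecture.Theses.AmpleAdicLefschetz.Assembly := by
  unfold Summit.HodgeConjecture.HodgeConjecture.Theses.AmpleAdicLefschetz.Assembly
  intro hM hW hH hMid hT hS
  -- (1) below the middle (2p + 1 ≤ n)
  have below : ∀ (n : ℕ) (X : SchemeOver ℂ), IsSmoothProjective n X → ∀ (p : ℕ), 2 * p + 1 ≤ n →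
      ∀ c : complexBetti X (2 * p), IsRationalClass c → IsOfHodgeType n X (2 * p) p p c →
        c ∈ algebraicClasses X p := by
    intro n X hX p hp c hc hh
    obtain ⟨m, Y, f, s, hY, hf, hs, hcov, hle, -, halg⟩ := hS hX hp c hc hh
    obtain ⟨a, ha, hfa⟩ := hT f hX hY hf s hs hcov hle _ halg (LinearMap.mem_range_self _ c)
    have hac : a = c := hW f hX hf s hs hcov (2 * p) hle hfa
    exact hac ▸ ha
  -- (2) at or below the middle (2p ≤ n): the middle degree is `MiddleStabilisation` fed with (1)
  -- in dimension 2p + 1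
  have key : ∀ (n : ℕ) (X : SchemeOver ℂ), IsSmoothProjective n X → ∀ (p : ℕ), 2 * p ≤ n →
      ∀ c : complexBetti X (2 * p), IsRationalClass c → IsOfHodgeType n X (2 * p) p p c →
        c ∈ algebraicClasses X p := by
    intro n X hX p hp c hc hh
    rcases Nat.lt_or_ge (2 * p) n with hlt | hge
    · exact below n X hX p hlt c hc hh
    · obtain rfl : n = 2 * p := le_antisymm hge hp
      exact hMid p (fun X' hX' c' hc' hh' => below (2 * p + 1) X' hX' p le_rfl c' hc' hh') hX c hc hh
  -- (3) every (n, p): above the middle (n < 2p) `HardLefschetzReduction` moves to degree 2(n - p)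
  intro n X hX
  refine ⟨hM n X hX, ?_⟩
  intro p c hc hh
  rcases Nat.lt_or_ge n (2 * p) with hlt | hge
  · exact hH n p hlt hX (fun c' hc' hh' => key n X hX (n - p) (by omega) c' hc' hh') c hc hh
  · exact key n X hX p hge c hc hh

end Summit.HodgeConjecture.HodgeConjecture.Theorems
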